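import Summits.NavierStokesRegularity.NavierStokesRegularity.Theorems.LerayQuarterDissipationFiniteDissipationLiouvilleTraceUniform
import Summits.NavierStokesRegularity.NavierStokesRegularity.Theorems.LerayQuarterDissipationRecurrentReductionDScaling
import Literature.Analysis.FluidPDE.TypeIAncientMildRescale
import HarnessLib

/-!
# Crux `FiniteDissipationLiouville` (stmt-NavierStokesRegularity-22144): the final datum of a
# uniformly RECURRENT member of the stratum is a uniformly recurrent point of the DILATION FLOW
# on `𝒟'(ℝ³)`

Theorems file of route `LerayQuarterDissipation` (lead prover g5; `--supports` the crux: the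
final-datum form of the residue of the WANDERING stub `stub_pastWanderingRecurrentLiouville` of the
line `birth`). Navier–Stokes regularity is NOT proved by anything here; no summit is.

`𝒟_{C,K}`: Type-I ancient mild fields `w` (`IsTypeIAncientMild C w`) with the quarter-rate law
`∫ ‖∇w(s)‖² ≤ K/√(−s)`. The Navier–Stokes dilations `w_c(t, x) = c w(c²t, c x)` (`nsRescale c w`,
`c > 0`) act on `𝒟_{C,K}` (`IsTypeIAncientMild.nsRescale`, `RecurrentReductionD.dissipationLaw_nsRescale`);
the recurrent reduction (child item 22507, proved) produces from any singular member a singular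
member `w` which is UNIFORMLY RECURRENT under `σ ↦ w_{e^σ}` (locally uniformly on compacts of the
open past); lead g3 proved that every member has a distributional trace `T_w(φ) = lim_{t→0⁻} ∫⟪w(t), φ⟫`
attained at the uniform rate `|∫⟪w(t), φ⟫ − T_w(φ)| ≤ M(C,K,φ) (−t)^{1/4}` (`exists_trace_rate_unif`).

* `integral_pairing_nsRescale`, `tendsto_pairing_nsRescale` — **the dilations act on traces**:
  `∫⟪w_c(t), φ⟫ = c⁻² ∫⟪w(c²t), φ(c⁻¹·)⟫`, hence `T_{w_c}(φ) = c⁻² T_w(φ(c⁻¹ ·))` — the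
  distribution `c u₀(c ·)` (lead g3's `trace_pastDss_homogeneous` is the fixed-point case).
* `exists_blowdown_slice_sub_trace_le`, `tendsto_blowdown_slice_sub_trace` — **SPATIAL INFINITY IS
  FROZEN IN TIME on the stratum**: `λ w(t₀, λ ·)` is the slice at time `t₀/λ² → 0⁻` of the dilate
  `w_λ ∈ 𝒟_{C,K}`, so by the UNIFORM trace rate `|∫⟪λw(t₀,λ·), φ⟫ − λ⁻² T_w(φ(λ⁻¹·))| ≤ M(−t₀)^{1/4}λ^{−1/2}`:
  the Navier–Stokes blow-downs of EVERY slice of a member of `𝒟` are asymptotic to the blow-downs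
  of its final datum (lead g2's blow-down / far-field / mass leaves tested one slice; they are
  statements about the trace).
* `trace_recurrent_of_recurrent` — **THE TRACE OF A UNIFORMLY RECURRENT MEMBER IS UNIFORMLY
  RECURRENT UNDER DILATIONS, in `𝒟'(ℝ³)`**: for every test field `φ` and `ε > 0` there is `L > 0`
  such that every window `[a, a + L]` contains `σ` with `|T_{w_{e^σ}}(φ) − T_w(φ)| ≤ ε`, i.e.
  `|e^{−2σ} T_w(φ(e^{−σ} ·)) − T_w(φ)| ≤ ε`. Proof: at the instant `t_* = −R⁻²` deep in the
  recurrence window the two slices are `ε'`-close on the support of `φ`, and both pairings are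
  within `M R^{−1/2}` of their traces by the UNIFORM rate (the dilate is again in `𝒟_{C,K}`).
* So the WANDERING stub now reads, in final-datum language (with the trace leaves of leads g3–g5:
  nonzero `exists_trace_ne_zero_of_singular`, critical-Morrey `exists_trace_morrey_bound`, bounded
  off `≤ c(K⁺)³` points `trace_bounded_off_singularSet`, unbounded support
  `exists_farField_trace_ne_zero_of_singular`): **a counterexample leaves a NONZERO final datum
  `u₀ ∈ M^{2,1}(ℝ³)`, bounded away from finitely many points, not compactly supported, whose
  dilation orbit `{c u₀(c ·)}_{c>0}` is uniformly recurrent in `𝒟'(ℝ³)`** — the exact analogue of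
  the homogeneous datum `c u₀(c ·) = u₀` of the DSS wall (lead g3 `trace_pastDss_homogeneous`),
  with periodicity of the orbit replaced by uniform recurrence.

References: G. Koch, N. Nadirashvili, G. Seregin, V. Šverák, Acta Math. 203 (2009), §1 (1.2);
G. D. Birkhoff, *Dynamical Systems* (1927), Ch. VII (uniform recurrence).
-/

noncomputable section

-- the summit and its single sub-problem share the name (CONVENTIONS §1), as in every Theorems file
set_option linter.dupNamespace false

namespace Summit.NavierStokesRegularity.NavierStokesRegularity.Theorems.FiniteDissipationLiouville.Birth.Apex

open MeasureTheory Set Filter Topology Metric Function TopologicalSpace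
open Literature.Analysis Literature.Analysis.FluidPDE
open scoped ENNReal NNReal RealInnerProductSpace

variable {C K : ℝ} {w : ℝ → EuclideanSpace ℝ (Fin 3) → EuclideanSpace ℝ (Fin 3)}

/-! ### The dilations act on the pairings and on the traces -/

/-- **Slice identity for a dilate**: `∫ ⟪w_c(t), φ⟫ = c⁻² ∫ ⟪w(c²t), φ(c⁻¹ ·)⟫` for `c > 0`
(`w_c = nsRescale c w`; the change of variables `x ↦ c x`, Jacobian `c³`). -/
theorem integral_pairing_nsRescale {c : ℝ} (hc : 0 < c)
    (φ : EuclideanSpace ℝ (Fin 3) → EuclideanSpace ℝ (Fin 3)) (t : ℝ) :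
    ∫ x, ⟪nsRescale c w t x, φ x⟫ = (c ^ 2)⁻¹ * ∫ y, ⟪w (c ^ 2 * t) y, φ (c⁻¹ • y)⟫ := by
  have hcne : c ≠ 0 := hc.ne'
  set f : EuclideanSpace ℝ (Fin 3) → ℝ := fun y => ⟪c • w (c ^ 2 * t) y, φ (c⁻¹ • y)⟫ with hf
  have h1 : (fun x => ⟪nsRescale c w t x, φ x⟫) = fun x => f (c • x) := by
    funext x
    simp only [hf, nsRescale_apply, smul_smul, inv_mul_cancel₀ hcne, one_smul]
  rw [h1, Measure.integral_comp_smul volume f c]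
  have hdet : |(c ^ Module.finrank ℝ (EuclideanSpace ℝ (Fin 3)))⁻¹| = (c ^ 3)⁻¹ := by
    rw [finrank_euclideanSpace_fin, abs_inv, abs_of_pos (pow_pos hc 3)]
  rw [hdet, smul_eq_mul]
  have h2 : ∫ y, f y = c * ∫ y, ⟪w (c ^ 2 * t) y, φ (c⁻¹ • y)⟫ := by
    simp only [hf, inner_smul_left, RCLike.conj_to_real]
    exact integral_const_mul c _
  rw [h2]
  field_simp

/-- **The trace of a dilate**: if `∫⟪w(s), φ(c⁻¹ ·)⟫ → L'` as `s → 0⁻`, then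
`∫⟪w_c(t), φ⟫ → c⁻² L'` as `t → 0⁻` (`c > 0`): the trace of `w_c` is the distribution
`c u₀(c ·)`, `u₀` the trace of `w`. -/
theorem tendsto_pairing_nsRescale {c : ℝ} (hc : 0 < c)
    {φ : EuclideanSpace ℝ (Fin 3) → EuclideanSpace ℝ (Fin 3)} {L' : ℝ}
    (hL' : Tendsto (fun s => ∫ y, ⟪w s y, φ (c⁻¹ • y)⟫) (𝓝[<] 0) (𝓝 L')) :
    Tendsto (fun t => ∫ x, ⟪nsRescale c w t x, φ x⟫) (𝓝[<] 0) (𝓝 ((c ^ 2)⁻¹ * L')) := by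
  have hc2 : 0 < c ^ 2 := by positivity
  -- `t ↦ c² t` maps `𝓝[<] 0` to `𝓝[<] 0`
  have hmap : Tendsto (fun t : ℝ => c ^ 2 * t) (𝓝[<] 0) (𝓝[<] 0) := by
    refine tendsto_nhdsWithin_of_tendsto_nhds_of_eventually_within _ ?_ ?_
    · have h : Tendsto (fun t : ℝ => c ^ 2 * t) (𝓝 0) (𝓝 (c ^ 2 * 0)) :=
        (continuous_const.mul continuous_id).tendsto 0
      rw [mul_zero] at h
      exact h.mono_left nhdsWithin_le_nhds
    · filter_upwards [self_mem_nhdsWithin] with t ht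
      exact mul_neg_of_pos_of_neg hc2 ht
  have h := (hL'.comp hmap).const_mul (c ^ 2)⁻¹
  refine h.congr fun t => ?_
  simp only [Function.comp_apply]
  exact (integral_pairing_nsRescale hc φ t).symm

/-! ### The pairing of two nearby slices -/

/-- **Two slices that are `ε'`-close on the support of a test field have `ε'∫‖φ‖`-close
pairings.** -/
theorem abs_integral_inner_sub_le {v₁ v₂ φ : EuclideanSpace ℝ (Fin 3) → EuclideanSpace ℝ (Fin 3)}
    (h₁ : Continuous v₁) (h₂ : Continuous v₂)
    (hφ : FunctionSpaces.IsTestFunctionOn (⊤ : Opens (EuclideanSpace ℝ (Fin 3))) φ) {ε' : ℝ}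
    (hclose : ∀ y, φ y ≠ 0 → ‖v₁ y - v₂ y‖ ≤ ε') :
    |(∫ y, ⟪v₁ y, φ y⟫) - ∫ y, ⟪v₂ y, φ y⟫| ≤ ε' * ∫ y, ‖φ y‖ := by
  have hcφ : Continuous φ := hφ.contDiff.continuous
  have hφcs : HasCompactSupport φ := hφ.hasCompactSupport
  have hi₁ : Integrable (fun y => ⟪v₁ y, φ y⟫) :=
    integrable_inner_of_continuous_of_hasCompactSupport h₁ hcφ hφcs
  have hi₂ : Integrable (fun y => ⟪v₂ y, φ y⟫) :=
    integrable_inner_of_continuous_of_hasCompactSupport h₂ hcφ hφcs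
  have hi₃ : Integrable (fun y => ⟪v₁ y - v₂ y, φ y⟫) :=
    integrable_inner_of_continuous_of_hasCompactSupport (h₁.sub h₂) hcφ hφcs
  have hi₄ : Integrable (fun y => ε' * ‖φ y‖) :=
    (hcφ.norm.integrable_of_hasCompactSupport hφcs.norm).const_mul ε'
  rw [← integral_sub hi₁ hi₂]
  have e : (fun y => ⟪v₁ y, φ y⟫ - ⟪v₂ y, φ y⟫) = fun y => ⟪v₁ y - v₂ y, φ y⟫ := by
    funext y
    rw [inner_sub_left]
  rw [e, ← Real.norm_eq_abs, ← integral_const_mul]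
  refine (norm_integral_le_integral_norm _).trans (integral_mono hi₃.norm hi₄ fun y => ?_)
  by_cases hy : φ y = 0
  · simp [hy]
  · exact (norm_inner_le_norm _ _).trans (mul_le_mul_of_nonneg_right (hclose y hy) (norm_nonneg _))

/-! ### Spatial infinity is frozen: the blow-downs of every slice are those of the trace -/

/-- **The Navier–Stokes blow-down of a slice is asymptotic to the blow-down of the trace, with the
uniform rate.** For every `C, K` and test field `φ` there is `M` such that for every member
`w ∈ 𝒟_{C,K}`, every `t₀ < 0` and every `λ > √(−t₀)`: if `T_λ` is the trace value of `w` against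
the dilated test field `φ(λ⁻¹ ·)`, then
`|∫⟪λ w(t₀, λx), φ(x)⟫ dx − λ⁻² T_λ| ≤ M (−t₀/λ²)^{1/4}`.
Indeed `λ w(t₀, λ ·)` is the slice at time `t₀/λ² ∈ (−1, 0)` of the dilate `w_λ ∈ 𝒟_{C,K}`, whose
trace against `φ` is `λ⁻² T_λ` (`tendsto_pairing_nsRescale`), and the trace is attained at the
uniform rate `M (−s)^{1/4}` (`exists_trace_rate_unif`). -/
theorem exists_blowdown_slice_sub_trace_le (C K : ℝ)
    {φ : EuclideanSpace ℝ (Fin 3) → EuclideanSpace ℝ (Fin 3)}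
    (hφ : FunctionSpaces.IsTestFunctionOn (⊤ : Opens (EuclideanSpace ℝ (Fin 3))) φ) :
    ∃ M : ℝ, ∀ (w : ℝ → EuclideanSpace ℝ (Fin 3) → EuclideanSpace ℝ (Fin 3)),
      IsTypeIAncientMild C w →
      (∀ s : ℝ, s < 0 → ∫⁻ x, ‖fderiv ℝ (w s) x‖ₑ ^ 2 ≤ ENNReal.ofReal (K / Real.sqrt (-s))) →
      ∀ t₀ < 0, ∀ lam : ℝ, Real.sqrt (-t₀) < lam →
      ∀ Tl : ℝ, Tendsto (fun t => ∫ x, ⟪w t x, φ (lam⁻¹ • x)⟫) (𝓝[<] 0) (𝓝 Tl) →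
        |(∫ x, ⟪lam • w t₀ (lam • x), φ x⟫) - (lam ^ 2)⁻¹ * Tl| ≤
          M * (-(t₀ / lam ^ 2)) ^ (1 / 4 : ℝ) := by
  obtain ⟨M, hM⟩ := exists_trace_rate_unif C K hφ
  refine ⟨M, fun w hw hlaw t₀ ht₀ lam hlam Tl hTl => ?_⟩
  have hsq : 0 < Real.sqrt (-t₀) := Real.sqrt_pos.2 (neg_pos.2 ht₀)
  have hlam0 : 0 < lam := hsq.trans hlam
  have hlam2 : 0 < lam ^ 2 := by positivity
  -- the dilate and its trace
  have hvD : IsTypeIAncientMild C (nsRescale lam w) := hw.nsRescale hlam0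
  have hvlaw : ∀ s : ℝ, s < 0 →
      ∫⁻ x, ‖fderiv ℝ (nsRescale lam w s) x‖ₑ ^ 2 ≤ ENNReal.ofReal (K / Real.sqrt (-s)) :=
    RecurrentReductionD.dissipationLaw_nsRescale hlaw hlam0
  have hTv := tendsto_pairing_nsRescale (w := w) hlam0 hTl
  -- the instant `s = t₀/λ² ∈ (−1, 0)`
  set s : ℝ := t₀ / lam ^ 2 with hs
  have hs0 : s < 0 := div_neg_of_neg_of_pos ht₀ hlam2
  have hs1 : -1 < s := by
    rw [hs, lt_div_iff₀ hlam2, neg_one_mul, neg_lt]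
    have h1 : -t₀ < lam ^ 2 := by
      calc -t₀ = Real.sqrt (-t₀) ^ 2 := (Real.sq_sqrt (neg_nonneg.2 ht₀.le)).symm
        _ < lam ^ 2 := pow_lt_pow_left₀ hlam hsq.le two_ne_zero
    linarith
  have h := hM (nsRescale lam w) hvD hvlaw _ hTv s ⟨hs1, hs0⟩
  -- the slice of the dilate at `s` is the blow-down `λ w(t₀, λ ·)`
  have e : (fun x => ⟪nsRescale lam w s x, φ x⟫) = fun x => ⟪lam • w t₀ (lam • x), φ x⟫ := by
    funext x
    rw [nsRescale_apply, hs, mul_div_cancel₀ _ hlam2.ne']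
  rw [e] at h
  exact h

/-- **Spatial infinity is frozen in time on the stratum: the blow-downs of any slice converge iff
the blow-downs of the trace do, to the same limit.** Let `w ∈ 𝒟_{C,K}`, `t₀ < 0`, `φ` a test
field, and let `T(λ)` be the trace values of `w` against `φ(λ⁻¹ ·)` (`λ > 0`). Then
`∫⟪λ w(t₀, λx), φ(x)⟫ dx − λ⁻² T(λ) → 0` as `λ → ∞`. In particular (with lead g2's blow-down /
far-field / mass leaves, which tested ONE slice) the Navier–Stokes blow-down of every slice of a
member of `𝒟` is the blow-down of its final datum: all slices and the trace share one asymptotic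
profile at spatial infinity. -/
theorem tendsto_blowdown_slice_sub_trace (hw : IsTypeIAncientMild C w)
    (hlaw : ∀ s : ℝ, s < 0 → ∫⁻ x, ‖fderiv ℝ (w s) x‖ₑ ^ 2 ≤ ENNReal.ofReal (K / Real.sqrt (-s)))
    {t₀ : ℝ} (ht₀ : t₀ < 0)
    {φ : EuclideanSpace ℝ (Fin 3) → EuclideanSpace ℝ (Fin 3)}
    (hφ : FunctionSpaces.IsTestFunctionOn (⊤ : Opens (EuclideanSpace ℝ (Fin 3))) φ)
    {T : ℝ → ℝ}
    (hT : ∀ lam : ℝ, 0 < lam →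
      Tendsto (fun t => ∫ x, ⟪w t x, φ (lam⁻¹ • x)⟫) (𝓝[<] 0) (𝓝 (T lam))) :
    Tendsto (fun lam : ℝ => (∫ x, ⟪lam • w t₀ (lam • x), φ x⟫) - (lam ^ 2)⁻¹ * T lam)
      atTop (𝓝 0) := by
  obtain ⟨M, hM⟩ := exists_blowdown_slice_sub_trace_le C K hφ
  have hsq : 0 < Real.sqrt (-t₀) := Real.sqrt_pos.2 (neg_pos.2 ht₀)
  -- the majorant `M (−t₀/λ²)^{1/4} → 0`
  have hmaj : Tendsto (fun lam : ℝ => M * (-(t₀ / lam ^ 2)) ^ (1 / 4 : ℝ)) atTop (𝓝 0) := by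
    have h1 : Tendsto (fun lam : ℝ => -(t₀ / lam ^ 2)) atTop (𝓝 0) := by
      have h2 : Tendsto (fun lam : ℝ => lam ^ 2) atTop atTop := tendsto_pow_atTop two_ne_zero
      have h3 : Tendsto (fun lam : ℝ => t₀ / lam ^ 2) atTop (𝓝 0) := h2.const_div_atTop t₀
      simpa using h3.neg
    have h4 : Tendsto (fun lam : ℝ => (-(t₀ / lam ^ 2)) ^ (1 / 4 : ℝ)) atTop (𝓝 0) := by
      have h5 := h1.rpow_const (p := (1 / 4 : ℝ)) (Or.inr (by norm_num))
      rwa [Real.zero_rpow (by norm_num)] at h5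
    simpa using h4.const_mul M
  rw [tendsto_zero_iff_abs_tendsto_zero]
  refine squeeze_zero' (Eventually.of_forall fun lam => abs_nonneg _) ?_ hmaj
  filter_upwards [eventually_gt_atTop (Real.sqrt (-t₀))] with lam hlam
  exact hM w hw hlaw t₀ ht₀ lam hlam (T lam) (hT lam (hsq.trans hlam))

/-! ### The trace of a recurrent member is recurrent under dilations -/

/-- **THE FINAL DATUM OF A UNIFORMLY RECURRENT MEMBER OF THE STRATUM IS A UNIFORMLY RECURRENT
POINT OF THE DILATION FLOW ON `𝒟'(ℝ³)`.** Let `w ∈ 𝒟_{C,K}` be uniformly recurrent under the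
Navier–Stokes dilations (the hypothesis of `stub_pastWanderingRecurrentLiouville`, produced by the
recurrent reduction 22507). Then for every test field `φ` and every `ε > 0` there is `L > 0` such
that every window `[a, a + L]` contains a log-scale `σ` at which the trace of the dilate
`w_{e^σ} = nsRescale (e^σ) w` against `φ` is within `ε` of the trace of `w`: whenever
`∫⟪w(t), φ⟫ → T` and `∫⟪w(t), φ(e^{−σ} ·)⟫ → T'` as `t → 0⁻` (both limits exist,
`exists_tendsto_pairing_finalSlice`), `|e^{−2σ} T' − T| ≤ ε`. -/
theorem trace_recurrent_of_recurrent (hw : IsTypeIAncientMild C w)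
    (hlaw : ∀ s : ℝ, s < 0 → ∫⁻ x, ‖fderiv ℝ (w s) x‖ₑ ^ 2 ≤ ENNReal.ofReal (K / Real.sqrt (-s)))
    (hrec : ∀ ε > 0, ∀ R > 1, ∃ L > 0, ∀ a : ℝ, ∃ σ ∈ Set.Icc a (a + L),
      ∀ s ∈ Set.Icc (-(R ^ 2)) (-(R⁻¹) ^ 2),
      ∀ y ∈ Metric.closedBall (0 : EuclideanSpace ℝ (Fin 3)) R,
        ‖Real.exp σ • w (Real.exp (2 * σ) * s) (Real.exp σ • y) - w s y‖ ≤ ε)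
    {φ : EuclideanSpace ℝ (Fin 3) → EuclideanSpace ℝ (Fin 3)}
    (hφ : FunctionSpaces.IsTestFunctionOn (⊤ : Opens (EuclideanSpace ℝ (Fin 3))) φ)
    {ε : ℝ} (hε : 0 < ε) :
    ∃ L > 0, ∀ a : ℝ, ∃ σ ∈ Set.Icc a (a + L), ∀ T T' : ℝ,
      Tendsto (fun t => ∫ x, ⟪w t x, φ x⟫) (𝓝[<] 0) (𝓝 T) →
      Tendsto (fun t => ∫ x, ⟪w t x, φ ((Real.exp σ)⁻¹ • x)⟫) (𝓝[<] 0) (𝓝 T') →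
        |(Real.exp σ ^ 2)⁻¹ * T' - T| ≤ ε := by
  -- ### constants: the uniform trace rate `M`, the support radius `R₀`, the mass `I = ∫‖φ‖`
  obtain ⟨M, hM⟩ := exists_trace_rate_unif C K hφ
  obtain ⟨R₀, hR₀0, hR₀⟩ := hφ.hasCompactSupport.isCompact.isBounded.subset_ball_lt 0
    (0 : EuclideanSpace ℝ (Fin 3))
  set I : ℝ := ∫ y, ‖φ y‖ with hI
  have hI0 : 0 ≤ I := integral_nonneg fun _ => norm_nonneg _
  -- `M ≥ 0` (test the rate on `w` itself at `t = −1/2`)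
  obtain ⟨T₀, hT₀⟩ := exists_tendsto_pairing_finalSlice hw hlaw hφ
  have hM0 : 0 ≤ M := by
    have h := hM w hw hlaw T₀ hT₀ (-(1 / 2)) ⟨by norm_num, by norm_num⟩
    have h1 : 0 < (-(-(1 / 2 : ℝ))) ^ (1 / 4 : ℝ) := Real.rpow_pos_of_pos (by norm_num) _
    nlinarith [abs_nonneg ((∫ x, ⟪w (-(1 / 2)) x, φ x⟫) - T₀)]
  -- ### the scale `R`: beyond the support, and with `2 M R^{-1/2} ≤ ε / 2`
  set R : ℝ := max (max R₀ 2) ((4 * M / ε) ^ 2 + 1) with hRdef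
  have hR1 : 1 < R := by
    rw [hRdef]; linarith [le_max_left (max R₀ 2) ((4 * M / ε) ^ 2 + 1), le_max_right R₀ 2]
  have hR0 : 0 < R := by linarith
  have hRR₀ : R₀ ≤ R := (le_max_left _ _).trans (le_max_left _ _)
  have hRM : (4 * M / ε) ^ 2 ≤ R := by
    rw [hRdef]; linarith [le_max_right (max R₀ 2) ((4 * M / ε) ^ 2 + 1)]
  -- the instant `t_* = −R⁻²` and the rate there
  set tS : ℝ := -(R⁻¹) ^ 2 with htS
  have hRinv : 0 < R⁻¹ := inv_pos.2 hR0
  have hRinv1 : R⁻¹ < 1 := inv_lt_one_of_one_lt₀ hR1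
  have htS0 : tS < 0 := by rw [htS]; exact neg_neg_of_pos (pow_pos hRinv 2)
  have htS1 : -1 < tS := by
    rw [htS]
    have : (R⁻¹) ^ 2 < 1 := pow_lt_one₀ hRinv.le hRinv1 two_ne_zero
    linarith
  have hrate : M * (-tS) ^ (1 / 4 : ℝ) ≤ ε / 4 := by
    have e1 : (-tS) ^ (1 / 4 : ℝ) = Real.sqrt (R⁻¹) := by
      rw [htS, neg_neg, Real.sqrt_eq_rpow, ← Real.rpow_natCast, ← Real.rpow_mul hRinv.le]
      norm_num
    rw [e1]
    -- `√(R⁻¹) ≤ ε / (4 (M + 1))`-type bound from `(4M/ε)² ≤ R`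
    by_cases hMz : M = 0
    · rw [hMz, zero_mul]; linarith
    have hMpos : 0 < M := lt_of_le_of_ne hM0 (Ne.symm hMz)
    have hq : 0 < 4 * M / ε := by positivity
    have h1 : Real.sqrt (R⁻¹) ≤ (4 * M / ε)⁻¹ := by
      rw [Real.sqrt_le_left (inv_nonneg.2 hq.le), inv_pow]
      exact inv_anti₀ (pow_pos hq 2) hRM
    calc M * Real.sqrt (R⁻¹) ≤ M * (4 * M / ε)⁻¹ := mul_le_mul_of_nonneg_left h1 hM0
      _ = ε / 4 := by field_simp
  -- ### recurrence with tolerance `ε' = ε / (2 (I + 1))` on the window of scale `R`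
  set ε' : ℝ := ε / (2 * (I + 1)) with hε'
  have hε'0 : 0 < ε' := by positivity
  obtain ⟨L, hL, hwin⟩ := hrec ε' hε'0 R hR1
  refine ⟨L, hL, fun a => ?_⟩
  obtain ⟨σ, hσ, hclose⟩ := hwin a
  refine ⟨σ, hσ, fun T T' hT hT' => ?_⟩
  -- ### the dilate `v = w_{e^σ}` is a member of `𝒟_{C,K}` with trace `e^{-2σ} T'`
  set c : ℝ := Real.exp σ with hc
  have hc0 : 0 < c := Real.exp_pos σ
  set v : ℝ → EuclideanSpace ℝ (Fin 3) → EuclideanSpace ℝ (Fin 3) := nsRescale c w with hv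
  have hvD : IsTypeIAncientMild C v := hw.nsRescale hc0
  have hvlaw : ∀ s : ℝ, s < 0 →
      ∫⁻ x, ‖fderiv ℝ (v s) x‖ₑ ^ 2 ≤ ENNReal.ofReal (K / Real.sqrt (-s)) :=
    RecurrentReductionD.dissipationLaw_nsRescale hlaw hc0
  have hTv : Tendsto (fun t => ∫ x, ⟪v t x, φ x⟫) (𝓝[<] 0) (𝓝 ((c ^ 2)⁻¹ * T')) :=
    tendsto_pairing_nsRescale hc0 hT'
  -- ### the three-ε estimate at `t_*`
  have h1 : |(∫ x, ⟪v tS x, φ x⟫) - (c ^ 2)⁻¹ * T'| ≤ M * (-tS) ^ (1 / 4 : ℝ) :=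
    hM v hvD hvlaw _ hTv tS ⟨htS1, htS0⟩
  have h2 : |(∫ x, ⟪w tS x, φ x⟫) - T| ≤ M * (-tS) ^ (1 / 4 : ℝ) :=
    hM w hw hlaw T hT tS ⟨htS1, htS0⟩
  have h3 : |(∫ x, ⟪v tS x, φ x⟫) - ∫ x, ⟪w tS x, φ x⟫| ≤ ε' * I := by
    refine abs_integral_inner_sub_le (hvD.continuous_slice htS0) (hw.continuous_slice htS0) hφ
      fun y hy => ?_
    -- `y` lies in the support ball, inside `closedBall 0 R`; `t_*` lies in the window
    have hyR : y ∈ closedBall (0 : EuclideanSpace ℝ (Fin 3)) R := by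
      have h := hR₀ (subset_tsupport _ (Function.mem_support.2 hy))
      rw [mem_ball_zero_iff] at h
      rw [mem_closedBall, dist_zero_right]
      linarith
    have htSI : tS ∈ Icc (-(R ^ 2)) (-(R⁻¹) ^ 2) := by
      refine ⟨?_, le_rfl⟩
      rw [htS, neg_le_neg_iff]
      calc (R⁻¹) ^ 2 ≤ 1 := pow_le_one₀ hRinv.le hRinv1.le
        _ ≤ R ^ 2 := by nlinarith
    have h := hclose tS htSI y hyR
    have h2σ : Real.exp (2 * σ) = c ^ 2 := by
      rw [hc, show (2 : ℝ) * σ = ((2 : ℕ) : ℝ) * σ by norm_num, Real.exp_nat_mul]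
    rw [h2σ] at h
    have e : v tS y = c • w (c ^ 2 * tS) (c • y) := by rw [hv, nsRescale_apply]
    rw [e]
    exact h
  -- assemble
  have hε'I : ε' * I ≤ ε / 2 := by
    rw [hε', div_mul_eq_mul_div, div_le_div_iff₀ (by positivity) (by norm_num)]
    nlinarith
  calc |(c ^ 2)⁻¹ * T' - T|
      = |((c ^ 2)⁻¹ * T' - ∫ x, ⟪v tS x, φ x⟫) + ((∫ x, ⟪v tS x, φ x⟫) - ∫ x, ⟪w tS x, φ x⟫) +
          ((∫ x, ⟪w tS x, φ x⟫) - T)| := by ring_nf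
    _ ≤ |(c ^ 2)⁻¹ * T' - ∫ x, ⟪v tS x, φ x⟫| + |(∫ x, ⟪v tS x, φ x⟫) - ∫ x, ⟪w tS x, φ x⟫| +
          |(∫ x, ⟪w tS x, φ x⟫) - T| := abs_add_three _ _ _
    _ ≤ M * (-tS) ^ (1 / 4 : ℝ) + ε' * I + M * (-tS) ^ (1 / 4 : ℝ) := by
        rw [abs_sub_comm] at h1
        exact add_le_add (add_le_add h1 h3) h2
    _ ≤ ε / 4 + ε / 2 + ε / 4 := add_le_add (add_le_add hrate hε'I) hrate
    _ = ε := by ring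

end Summit.NavierStokesRegularity.NavierStokesRegularity.Theorems.FiniteDissipationLiouville.Birth.Apex

end
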